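import Literature.NumberTheory.EllipticCurves.BSDQuadraticDescent
import Literature.NumberTheory.EllipticCurves.BSDQuadraticDescentArchimedeanProofs
import HarnessLib

/-!
# The BSD quotient under quadratic base change: elimination of the periods

`Proofs` file (theorems only, no definitions, no named facts) in topic
`NumberTheory/EllipticCurves`, supporting the named fact
`WeierstrassCurve.bsdRHS_baseChange_quadratic` of `BSDQuadraticDescent` (Milne, Invent. Math. 17
(1972), §1 Thm. 1 for the Weil restriction `Res_{K/ℚ} E_K ∼ E × E^{(D)}`, in the quotient form of
Dokchitser–Dokchitser, Ann. of Math. 172 (2010), §2.1, Conj. 6 and proof of Thm. 8): for `W/ℚ`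
globally minimal, `K` imaginary quadratic of discriminant `D = d_K`, `Wd = C_d • W^{(D)}` a globally
minimal model of the twist and `W' = C' • W_K` a globally minimal `K`-model, with `E(K)` and
`Ш(E_K/K)` finite,
`Ω(E_K/K) · #Ш(W') · ∏_w c_w(W') / #W'(K)² = RHS(W) · RHS(Wd)`, `Ω(E_K/K) = W'.bsdPeriod`.

The two sides contain three transcendental factors — `W'.bsdPeriod = 2 covol(Λ_{W'})/√|d_K|` on
the left, `Ω(W) = W.realPeriodRat` and `Ω(Wd)` on the right — and these are related by the
archimedean comparison already in the tree,
`WeierstrassCurve.realPeriod_mul_realPeriod_quadraticTwist_eq_mul_bsdPeriod`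
(`BSDQuadraticDescentArchimedeanProofs`: `Ω(W_ℝ) · Ω(W^{(d_K)}_ℝ) = n_W · bsdPeriod(W_K)`, `n_W` the
number of connected components of `W(ℝ)`), together with the behaviour of the periods under the
changes of variables to the minimal models (`bsdPeriod (C' • W_K) = |N_{K/ℚ}(u')| · bsdPeriod W_K`,
`WeierstrassCurve.bsdPeriod_smul'`; `Ω(C_d • W^{(D)}) = |u_d| · Ω(W^{(D)})`,
`WeierstrassCurve.realPeriodRat_smul_holds`).  Dividing them out leaves an identity of RATIONAL
numbers.  This file proves that reduction:

* `WeierstrassCurve.bsdQuotient_baseChange_quadratic_eq_iff` (**pointwise**): for the data above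
  (no minimality needed for the equivalence itself), the displayed identity of real numbers holds
  if and only if
  `|N_{K/ℚ}(u')| · #Ш(W') · ∏_w c_w(W') · #W(ℚ)² · #Wd(ℚ)²
     = n_W · |u_d| · #Ш(W) · #Ш(Wd) · ∏_p c_p(W) · ∏_p c_p(Wd) · #W'(K)²`
  in `ℚ` (all factors natural numbers except the two scalars `|N_{K/ℚ}(u')|`, `|u_d|`);
* `WeierstrassCurve.bsdRHS_baseChange_quadratic_of_card_identity`: hence the named fact follows
  from that identity of rationals (quantified over the same data), and conversely
  `WeierstrassCurve.card_identity_of_bsdRHS_baseChange_quadratic`;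
* `WeierstrassCurve.numRealComponents_baseChange_real`: `n_W = 2` if `Δ(W) > 0`, else `1`.

In Milne's proof (loc. cit., §1, and *Arithmetic Duality Theorems* I.7.3 for the isogeny
`E × E^{(D)} → Res_{K/ℚ} E_K`) the remaining identity is the product over all places of the local
indices `#coker/#ker` of that isogeny on points (Tamagawa numbers, the scalars `u'`, `u_d`, and
`n_W = #E(ℝ)[2]/2` at the infinite place) against the `2`-primary parts of `Ш` and of the finite
Mordell–Weil groups (Cassels–Tate pairing and Poitou–Tate duality, *ADT* (7.3.1)); its odd-primary
`Ш`-part is the tree's `WeierstrassCurve.card_primaryComponent_sha_baseChange_quadratic_of_odd`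
(`BSDQuadraticDescentShaOddPartProofs`).  Nothing of that global duality is used or asserted here.

## References

* J. S. Milne, *On the arithmetic of abelian varieties*, Invent. Math. 17 (1972), 177–190, §1
  Thm. 1, §2. [Milne1972ArithmeticAV]
* T. Dokchitser, V. Dokchitser, *On the Birch–Swinnerton-Dyer quotients modulo squares*, Ann. of
  Math. 172 (2010), §2.1, Conj. 6 and proof of Thm. 8 (arXiv p. 5). [DokchitserDokchitserAnnals2010]
* J. S. Milne, *Arithmetic Duality Theorems*, 2nd ed. (2006), Thm. I.7.3 and (7.3.1). [MilneADT2006]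

## Design

Theorems only (D-0026).  The residual identity is stated in `ℚ` with the casts of the natural
numbers `shaOrder`, `tamagawaProduct`, `Nat.card`, `numRealComponents`; the models `Wd`, `W'` are
quantified together with the changes of variables `C_d`, `C'` producing them (their scaling factors
enter the identity), exactly parallel to the existential hypotheses of the named fact.
`noncomputable section`, `open scoped Classical` as in the topic.
-/

noncomputable section

open scoped Classical

open NumberField

namespace WeierstrassCurve

open Literature.NumberTheory.EllipticCurves Literature.NumberTheory.QuadraticFields

/-! ### The number of real components of `W/ℚ` -/

/-- The number of connected components of `W(ℝ)` for a Weierstrass equation over `ℚ`: `2` if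
`Δ(W) > 0`, `1` otherwise (`numRealComponents` of the base change to `ℝ`, whose discriminant is
`Δ(W)` viewed in `ℝ`). Cremona, *Algorithms for Modular Elliptic Curves*, §3.7. [folklore] -/
theorem numRealComponents_baseChange_real (W : WeierstrassCurve ℚ) :
    (W.baseChange ℝ).numRealComponents = if 0 < W.Δ then 2 else 1 := by
  have hΔ : (W.baseChange ℝ).Δ = (W.Δ : ℝ) := by
    simp [baseChange, map_Δ]
  simp only [numRealComponents, hΔ, Rat.cast_pos]

/-! ### Finiteness of the Mordell–Weil groups in sight -/

section Finite

variable (W : WeierstrassCurve ℚ) (K : Type) [Field K] [NumberField K]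

/-- If a `K`-model `W' = C' • W_K` has finitely many `K`-points then `W(ℚ)` is finite
(`W(ℚ) ↪ W_K(K) ≅ W'(K)`). [folklore] -/
theorem finite_point_of_finite_point_smul_baseChange {W' : WeierstrassCurve K}
    {C' : VariableChange K} (hW' : C' • W.baseChange K = W') [Finite W'.toAffine.Point] :
    Finite W.toAffine.Point := by
  subst hW'
  haveI : Finite (W.baseChange K).toAffine.Point :=
    Finite.of_equiv _ (VariableChange.pointEquiv (W.baseChange K) C').toEquiv.symm
  exact finite_point_of_finite_point_baseChange W K

/-- If `[K : ℚ] = 2` and a `K`-model `W' = C' • W_K` has finitely many `K`-points then every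
`ℚ`-model `Wd = C_d • W^{(d_K)}` of the twist by the discriminant has finitely many `ℚ`-points:
`K = ℚ(θ)`, `θ² = c`, `d_K = c q²` (`Quadratic.exists_sq_eq_algebraMap`,
`NumberField.exists_discr_eq_mul_sq`), `W^{(d_K)} ≅ W^{(c)}` over `ℚ` and
`W^{(c)}(ℚ) ↪ W_K(K)` (`finite_point_quadraticTwist_of_finite_point_baseChange`,
Silverman *AEC* X.5.4). [cite: SilvermanAEC2009, X.5 Cor. 5.4 and Exercise 10.16] -/
theorem finite_point_twist_of_finite_point_smul_baseChange (h2 : Module.finrank ℚ K = 2)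
    {Wd : WeierstrassCurve ℚ} {Cd : VariableChange ℚ}
    (hWd : Cd • W.quadraticTwist (NumberField.discr K : ℚ) = Wd)
    {W' : WeierstrassCurve K} {C' : VariableChange K} (hW' : C' • W.baseChange K = W')
    [Finite W'.toAffine.Point] : Finite Wd.toAffine.Point := by
  subst hWd hW'
  obtain ⟨θ, c, hθ, hc⟩ := Quadratic.exists_sq_eq_algebraMap (F := ℚ) (K := K) h2
  obtain ⟨q, hq, hd⟩ := NumberField.exists_discr_eq_mul_sq h2 hθ hc
  obtain ⟨C₁, hC₁⟩ := W.exists_variableChange_quadraticTwist_mul_sq c q hq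
  rw [← hd] at hC₁
  haveI : Finite (W.baseChange K).toAffine.Point :=
    Finite.of_equiv _ (VariableChange.pointEquiv (W.baseChange K) C').toEquiv.symm
  haveI : Finite (W.quadraticTwist c).toAffine.Point :=
    finite_point_quadraticTwist_of_finite_point_baseChange W K hθ hc
  haveI : Finite (W.quadraticTwist (NumberField.discr K : ℚ)).toAffine.Point := by
    rw [← hC₁]
    exact Finite.of_equiv _ (VariableChange.pointEquiv (W.quadraticTwist c) C₁).toEquiv
  exact Finite.of_equiv _ (VariableChange.pointEquiv _ Cd).toEquiv

end Finite

/-! ### Elimination of the periods -/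

/-- **The BSD-quotient identity under quadratic base change is an identity of rationals.** Let
`W/ℚ` be an elliptic curve, `K` an imaginary quadratic field (`[K : ℚ] = 2`, totally complex) of
discriminant `D = d_K`, `Wd = C_d • W^{(D)}` a `ℚ`-model of the twist, `W' = C' • W_K` a `K`-model
of the base change with `W'(K)` finite, `u_d = u(C_d) ∈ ℚˣ`, `u' = u(C') ∈ Kˣ`, and `n_W` the
number of connected components of `W(ℝ)`. Then
`W'.bsdPeriod · #Ш(W') · ∏_w c_w(W') / #W'(K)² = RHS(W) · RHS(Wd)` (the identity of
`bsdRHS_baseChange_quadratic`, `RHS = bsdRHS = #Ш · Reg · Ω · ∏ c_p / #E(ℚ)_tors²`) holds if and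
only if
`|N_{K/ℚ}(u')| · #Ш(W') · ∏_w c_w(W') · #W(ℚ)² · #Wd(ℚ)²
   = n_W · |u_d| · #Ш(W) · #Ш(Wd) · ∏_p c_p(W) · ∏_p c_p(Wd) · #W'(K)²`.
Proof: `W(ℚ)` and `Wd(ℚ)` are finite, so all regulators are `1` and the torsion orders are the
orders of the Mordell–Weil groups (`bsdRHS_eq_of_finite`); `W'.bsdPeriod = |N(u')| · bsdPeriod(W_K)`
(`bsdPeriod_smul'`), `Ω(Wd) = |u_d| · Ω(W^{(D)})` (`realPeriodRat_smul_holds`), and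
`Ω(W) · Ω(W^{(D)}) = n_W · bsdPeriod(W_K)` (`realPeriod_mul_realPeriod_quadraticTwist_eq_mul_bsdPeriod`,
the real-lattice computation `2 covol(Λ) = n_W Ω₀ Ω₀'`, Cremona §2.10 / Milne 1972 §2), with
`bsdPeriod(W_K) > 0` (`bsdPeriod_pos'`); clearing the common positive factor
`bsdPeriod(W_K) / (#W'(K)² #W(ℚ)² #Wd(ℚ)²)` gives the equivalence.
[cite: Milne1972ArithmeticAV, §1 Thm. 1 and §2 (through DokchitserDokchitserAnnals2010, §2.1, proof of Thm. 8)] -/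
theorem bsdQuotient_baseChange_quadratic_eq_iff (W : WeierstrassCurve ℚ) [W.IsElliptic]
    (K : Type) [Field K] [NumberField K] [IsTotallyComplex K] (h2 : Module.finrank ℚ K = 2)
    {Wd : WeierstrassCurve ℚ} {Cd : VariableChange ℚ}
    (hWd : Cd • W.quadraticTwist (NumberField.discr K : ℚ) = Wd)
    {W' : WeierstrassCurve K} {C' : VariableChange K} (hW' : C' • W.baseChange K = W')
    [Finite W'.toAffine.Point] :
    W'.bsdPeriod * (W'.shaOrder : ℝ) * (W'.tamagawaProduct : ℝ) /
          (Nat.card W'.toAffine.Point : ℝ) ^ 2 = W.bsdRHS * Wd.bsdRHS ↔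
      (|Algebra.norm ℚ (C'.u : K)| * W'.shaOrder * W'.tamagawaProduct *
            (Nat.card W.toAffine.Point) ^ 2 * (Nat.card Wd.toAffine.Point) ^ 2 : ℚ) =
        (W.baseChange ℝ).numRealComponents * |(Cd.u : ℚ)| * W.shaOrder * Wd.shaOrder *
          W.tamagawaProduct * Wd.tamagawaProduct * (Nat.card W'.toAffine.Point) ^ 2 := by
  -- finiteness of `W(ℚ)` and `Wd(ℚ)`
  haveI hfinQ : Finite W.toAffine.Point := finite_point_of_finite_point_smul_baseChange W K hW'
  haveI hfinD : Finite Wd.toAffine.Point :=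
    finite_point_twist_of_finite_point_smul_baseChange W K h2 hWd hW'
  subst hWd hW'
  haveI hEK : (W.baseChange K).IsElliptic := by rw [baseChange]; infer_instance
  -- the periods
  set P : ℝ := (W.baseChange K).bsdPeriod with hP_def
  have hP : 0 < P := bsdPeriod_pos' _
  have hP' : (C' • W.baseChange K).bsdPeriod = ((|Algebra.norm ℚ (C'.u : K)| : ℚ) : ℝ) * P :=
    (W.baseChange K).bsdPeriod_smul' C'
  have hΩd : (Cd • W.quadraticTwist (NumberField.discr K : ℚ)).realPeriodRat =
      |((Cd.u : ℚ) : ℝ)| * (W.quadraticTwist (NumberField.discr K : ℚ)).realPeriodRat :=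
    (W.quadraticTwist (NumberField.discr K : ℚ)).realPeriodRat_smul_holds Cd
  have hA5 : W.realPeriodRat * (W.quadraticTwist (NumberField.discr K : ℚ)).realPeriodRat =
      ((W.baseChange ℝ).numRealComponents : ℝ) * P :=
    realPeriod_mul_realPeriod_quadraticTwist_eq_mul_bsdPeriod W K h2
  -- positivity of the orders of the (finite, non-empty) Mordell–Weil groups
  have hN' : (Nat.card (C' • W.baseChange K).toAffine.Point : ℝ) ≠ 0 := by
    exact_mod_cast (Nat.card_pos (α := (C' • W.baseChange K).toAffine.Point)).ne'
  have hN : (Nat.card W.toAffine.Point : ℝ) ≠ 0 := by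
    exact_mod_cast (Nat.card_pos (α := W.toAffine.Point)).ne'
  have hNd : (Nat.card (Cd • W.quadraticTwist (NumberField.discr K : ℚ)).toAffine.Point : ℝ) ≠ 0 := by
    exact_mod_cast
      (Nat.card_pos (α := (Cd • W.quadraticTwist (NumberField.discr K : ℚ)).toAffine.Point)).ne'
  rw [W.bsdRHS_eq_of_finite, (Cd • W.quadraticTwist (NumberField.discr K : ℚ)).bsdRHS_eq_of_finite,
    hP', hΩd, div_mul_div_comm, div_eq_div_iff (pow_ne_zero 2 hN') (mul_ne_zero (pow_ne_zero 2 hN)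
      (pow_ne_zero 2 hNd))]
  -- regroup so that `Ω(W) Ω(W^{(D)}) = n_W P` can be substituted and `P > 0` cancelled
  have e1 : ((|Algebra.norm ℚ (C'.u : K)| : ℚ) : ℝ) * P * ((C' • W.baseChange K).shaOrder : ℝ) *
        ((C' • W.baseChange K).tamagawaProduct : ℝ) *
        ((Nat.card W.toAffine.Point : ℝ) ^ 2 *
          (Nat.card (Cd • W.quadraticTwist (NumberField.discr K : ℚ)).toAffine.Point : ℝ) ^ 2) =
      P * (((|Algebra.norm ℚ (C'.u : K)| : ℚ) : ℝ) * ((C' • W.baseChange K).shaOrder : ℝ) *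
        ((C' • W.baseChange K).tamagawaProduct : ℝ) * (Nat.card W.toAffine.Point : ℝ) ^ 2 *
          (Nat.card (Cd • W.quadraticTwist (NumberField.discr K : ℚ)).toAffine.Point : ℝ) ^ 2) := by
    ring
  have e2 : (W.shaOrder : ℝ) * W.realPeriodRat * (W.tamagawaProduct : ℝ) *
        (((Cd • W.quadraticTwist (NumberField.discr K : ℚ)).shaOrder : ℝ) *
          (|((Cd.u : ℚ) : ℝ)| * (W.quadraticTwist (NumberField.discr K : ℚ)).realPeriodRat) *
          ((Cd • W.quadraticTwist (NumberField.discr K : ℚ)).tamagawaProduct : ℝ)) *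
        (Nat.card (C' • W.baseChange K).toAffine.Point : ℝ) ^ 2 =
      (W.realPeriodRat * (W.quadraticTwist (NumberField.discr K : ℚ)).realPeriodRat) *
        (|((Cd.u : ℚ) : ℝ)| * (W.shaOrder : ℝ) *
          ((Cd • W.quadraticTwist (NumberField.discr K : ℚ)).shaOrder : ℝ) * (W.tamagawaProduct : ℝ) *
          ((Cd • W.quadraticTwist (NumberField.discr K : ℚ)).tamagawaProduct : ℝ) *
          (Nat.card (C' • W.baseChange K).toAffine.Point : ℝ) ^ 2) := by
    ring
  have e3 : ((W.baseChange ℝ).numRealComponents : ℝ) * P *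
        (|((Cd.u : ℚ) : ℝ)| * (W.shaOrder : ℝ) *
          ((Cd • W.quadraticTwist (NumberField.discr K : ℚ)).shaOrder : ℝ) * (W.tamagawaProduct : ℝ) *
          ((Cd • W.quadraticTwist (NumberField.discr K : ℚ)).tamagawaProduct : ℝ) *
          (Nat.card (C' • W.baseChange K).toAffine.Point : ℝ) ^ 2) =
      P * (((W.baseChange ℝ).numRealComponents : ℝ) * |((Cd.u : ℚ) : ℝ)| * (W.shaOrder : ℝ) *
          ((Cd • W.quadraticTwist (NumberField.discr K : ℚ)).shaOrder : ℝ) * (W.tamagawaProduct : ℝ) *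
          ((Cd • W.quadraticTwist (NumberField.discr K : ℚ)).tamagawaProduct : ℝ) *
          (Nat.card (C' • W.baseChange K).toAffine.Point : ℝ) ^ 2) := by
    ring
  rw [e1, e2, hA5, e3, mul_right_inj' hP.ne']
  constructor
  · intro h
    exact_mod_cast h
  · intro h
    exact_mod_cast h

/-! ### The named fact reduced to the identity of rationals, and conversely -/

/-- **`bsdRHS_baseChange_quadratic` from the identity of rationals.** If for every globally
minimal elliptic `W/ℚ`, every imaginary quadratic `K` (`D = d_K`), every globally minimal model
`Wd = C_d • W^{(D)}` and every globally minimal `K`-model `W' = C' • W_K` with `W'(K)` and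
`Ш(W'/K)` finite one has
`|N_{K/ℚ}(u')| · #Ш(W') · ∏_w c_w(W') · #W(ℚ)² · #Wd(ℚ)²
   = n_W · |u_d| · #Ш(W) · #Ш(Wd) · ∏_p c_p(W) · ∏_p c_p(Wd) · #W'(K)²`,
then the BSD quotient of `E_K/K` is the product of those of `E/ℚ` and `E^{(D)}/ℚ` in the
rank-zero shape of the named fact (Milne 1972, Thm. 1; Dokchitser–Dokchitser 2010, proof of
Thm. 8). The hypothesis is what Milne's proof establishes through the local indices of the
isogeny `E × E^{(D)} → Res_{K/ℚ} E_K` and global duality; see the module docstring.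
[cite: Milne1972ArithmeticAV, §1 Thm. 1 and §2 (through DokchitserDokchitserAnnals2010, §2.1, proof of Thm. 8)] -/
theorem bsdRHS_baseChange_quadratic_of_card_identity
    (h : ∀ (W : WeierstrassCurve ℚ) [W.IsElliptic] [W.IsGloballyMinimal]
      (K : Type) [Field K] [NumberField K] [IsTotallyComplex K], Module.finrank ℚ K = 2 →
      ∀ (Wd : WeierstrassCurve ℚ) [Wd.IsElliptic] [Wd.IsGloballyMinimal] (Cd : VariableChange ℚ),
        Cd • W.quadraticTwist (NumberField.discr K : ℚ) = Wd →
      ∀ (W' : WeierstrassCurve K) [W'.IsElliptic] [W'.IsGloballyMinimal] (C' : VariableChange K),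
        C' • W.baseChange K = W' → Finite W'.toAffine.Point → W'.ShaFinite →
        (|Algebra.norm ℚ (C'.u : K)| * W'.shaOrder * W'.tamagawaProduct *
              (Nat.card W.toAffine.Point) ^ 2 * (Nat.card Wd.toAffine.Point) ^ 2 : ℚ) =
          (W.baseChange ℝ).numRealComponents * |(Cd.u : ℚ)| * W.shaOrder * Wd.shaOrder *
            W.tamagawaProduct * Wd.tamagawaProduct * (Nat.card W'.toAffine.Point) ^ 2) :
    bsdRHS_baseChange_quadratic := by
  intro W _ _ K _ _ _ h2 Wd _ _ hWd W' _ _ hW' hfin hsha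
  obtain ⟨Cd, hCd⟩ := hWd
  obtain ⟨C', hC'⟩ := hW'
  haveI := hfin
  exact (bsdQuotient_baseChange_quadratic_eq_iff W K h2 hCd hC').mpr
    (h W K h2 Wd Cd hCd W' C' hC' hfin hsha)

/-- **Conversely**, the named fact `bsdRHS_baseChange_quadratic` yields the identity of rationals
for all such data (so the two are equivalent formulations; Milne 1972, Thm. 1).
[cite: Milne1972ArithmeticAV, §1 Thm. 1 and §2 (through DokchitserDokchitserAnnals2010, §2.1, proof of Thm. 8)] -/
theorem card_identity_of_bsdRHS_baseChange_quadratic (h : bsdRHS_baseChange_quadratic)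
    (W : WeierstrassCurve ℚ) [W.IsElliptic] [W.IsGloballyMinimal]
    (K : Type) [Field K] [NumberField K] [IsTotallyComplex K] (h2 : Module.finrank ℚ K = 2)
    (Wd : WeierstrassCurve ℚ) [Wd.IsElliptic] [Wd.IsGloballyMinimal] (Cd : VariableChange ℚ)
    (hWd : Cd • W.quadraticTwist (NumberField.discr K : ℚ) = Wd)
    (W' : WeierstrassCurve K) [W'.IsElliptic] [W'.IsGloballyMinimal] (C' : VariableChange K)
    (hW' : C' • W.baseChange K = W') (hfin : Finite W'.toAffine.Point) (hsha : W'.ShaFinite) :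
    (|Algebra.norm ℚ (C'.u : K)| * W'.shaOrder * W'.tamagawaProduct *
          (Nat.card W.toAffine.Point) ^ 2 * (Nat.card Wd.toAffine.Point) ^ 2 : ℚ) =
      (W.baseChange ℝ).numRealComponents * |(Cd.u : ℚ)| * W.shaOrder * Wd.shaOrder *
        W.tamagawaProduct * Wd.tamagawaProduct * (Nat.card W'.toAffine.Point) ^ 2 := by
  haveI := hfin
  exact (bsdQuotient_baseChange_quadratic_eq_iff W K h2 hWd hW').mp
    (h W K h2 Wd ⟨Cd, hWd⟩ W' ⟨C', hW'⟩ hfin hsha)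

end WeierstrassCurve

end
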